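import Mathlib
import Literature.MathematicalPhysics.QuantumFieldTheory.Balaban1983to89.Beta.OneLoop

/-!
# `Balaban1983to89.Beta.FamilyRegularity` — BETA sub-cell, kernel node BETA-0-LOGZREG-KERNEL: REGULARITY of the
constrained Gaussian normalisation IN THE BACKGROUND FIELD — generic discharge lemmas for the hypothesis fields
`OneLoopDictionary.regular` / `OneLoopDictionary.smooth` of `…Beta.OneLoop` v1.2 (cell GAPS G-beta-7), kernel-checked

HONEST FRAMING (BETA-SPEC.md, verbatim): discharging `BetaPertH` makes Bałaban's UV stability UNCONDITIONAL — a real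
constructive-QFT result; it is NOT the continuum limit and NOT the Clay problem.  THIS MODULE DISCHARGES NOTHING of the
series: it proves, as theorems of finite-dimensional calculus, that the two REGULARITY HYPOTHESES unit pv25's landed
module `…Beta.OneLoop` (v1.2, p177369) places on a background family `F : Beta.Family ι n m` — `Regular` near `B = 0` and
`log Z` twice differentiable at `B = 0`, without which the printed Hessian (1.20) is a junk value — FOLLOW from
continuity resp. differentiability of the family's DATA `B ↦ (Q(B), Δ(B))` together with `Regular` resp. `det K ≠ 0` AT the
base point.  Value = kernel lemma about matrices and `C^k` functions, NOT summit progress.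

CITATION HEADER (lean-in-tree rule 2026-08-18).  The printed object, verbatim:
* T. Bałaban, *Renormalization group approach to lattice gauge field theories. I*, Commun. Math. Phys. **109**, 249–301
  (1987) [Balaban1987RG1] (cell paper B12; PDF page = journal page − 248), p. 264 [PDF 16]: *"Now we describe the most
  important expressions in (1.3), (1.6), the β-functions β_{j+1}(g_j). They are determined by the functions
  E^{(j+1)}(g_j, U_{j+1}) in (1.6). Let us denote E^{(j+1)}(g_j, B) = E^{(j+1)}(g_j, U_{j+1}(exp iB)). We define
  Π^{ab}_{j+1,μν}(g_j, x, x′) = (δ²/(δB^a_μ(x)δB^b_ν(x′)) E^{(j+1)})(g_j, 0). (1.20) This is the vacuum polarization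
  tensor of the theory defined by the j-th fluctuation field integral."*  The display PRESUPPOSES that `B ↦ E^{(j+1)}(g_j, B)`
  is twice differentiable at `B = 0`; no statement to that effect is printed on pp. 263–264 (cell GAPS G-beta-7, referee
  REFEREE-BETA.md v2 R13–R15), which is why `…Beta.OneLoop` v1.2 carries it as the HYPOTHESIS field
  `OneLoopDictionary.smooth` (and `Regular` near `0` as `OneLoopDictionary.regular`).
* The objects regularity is asked OF: [Balaban1987RG1] (1.4) p. 260 [PDF 12] *"Z^{(j)}(U_k) = ∫ dB δ(Q̃B)
  exp\[−½⟨B, Δ^{(j)}(U_k)B⟩\]"* (quoted in full in `…Beta.OneLoop` / `…Beta.GaussianIntegral`), modelled in the tree by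
  `ConstrainedGaussian.logZ Z := ((n − m)/2)·log 2π − ½·log |det [[Δ, Qᵀ],[Q, 0]]|` and, along a background family
  `F : Family ι n m := (ι → ℝ) → ConstrainedGaussian n m`, by `Family.logZ F := fun B ↦ (F B).logZ`; B9's reduced variant
  `Family.logZred F C := fun B ↦ (r/2)·log 2π − ½·log det(CᵀΔ(B)C)` ([Balaban1985BackgroundPropagators] (3.157) p. 428).

WHAT IS PROVED (0 sorry; Mathlib only + the definitions of `…Beta.OneLoop`; every decl [folklore] calculus / linear algebra):
(1) `contDiffAt_matrix_det`, `continuousAt_matrix_det`: the determinant of a matrix-valued map is `C^k` (resp. continuous)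
    at a point as soon as its entries are (Leibniz expansion `Matrix.det_apply'`).
(2) `mulVec_surjective_iff_det_mul_transpose_ne_zero`: a real `p × q` matrix `Q` is onto iff `det(QQᵀ) ≠ 0` — so "onto"
    is an OPEN condition in `Q`.
(3) `Family.eventually_regular` — `Regular` IS OPEN IN THE BACKGROUND: if `B ↦ Q(B)` and `B ↦ Δ(B)` are continuous at `B₀`,
    `Δ(B)` is symmetric for `B` near `B₀`, and `(F B₀).Regular`, then `(F B).Regular` for all `B` near `B₀` (onto: by (2);
    positivity on the moving kernel `ker Q(B)`: compactness of the unit sphere, `IsCompact.eventually_forall_of_forall_eventually`).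
    With `B₀ = 0` this is exactly the field `OneLoopDictionary.regular` for the slice `model k t`.
(4) `Family.contDiffAt_logZ` — SMOOTHNESS OF `log Z` IN THE BACKGROUND: if the entries of `Q(·)`, `Δ(·)` are `C^k` at `B₀`
    and `det (F B₀).kkt ≠ 0`, then `F.logZ` is `C^k` at `B₀` (`Real.log` is `C^∞` off `0`); `Family.contDiffAt_logZred`: the
    same for `F.logZred C` from `Δ(·)` alone and `det(CᵀΔ(B₀)C) ≠ 0`.  With `B₀ = 0`, `k = 2` this is the field
    `OneLoopDictionary.smooth`; `Family.eventually_det_kkt_ne_zero`: `det K(B) ≠ 0` persists near `B₀`.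
    The hypothesis `det (F B₀).kkt ≠ 0` is all that smoothness needs; that it follows from `(F B₀).Regular` is the PUBLIC
    statement of unit pv23 (`…Beta.KKTBridge` (a), in preparation) and is NOT restated here.

WHAT IS NOT HERE.  Nothing about Bałaban's actual `Q̃(U_{k+1}(exp iB))`, `Δ^{(k)}(U)` is asserted — that they are
polynomial / real-analytic in `B` on the small-field region (so that (3), (4) apply) is for the rows that BUILD concrete
`Family`s (AN1 Table T, OBJECTS.md §5) to record from [Balaban1985BackgroundPropagators] / [Balaban1987RG1] Sect. 2;
the interchange of the `ε ↓ 0` regularisation of `…Beta.GaussianIntegral` with B-derivatives is not treated; no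
manuscript step is adjudicated (GAPS row C-pv16-3 is a KERNEL certification of this file only).
-/

noncomputable section

open Matrix Topology Filter

namespace Literature.MathematicalPhysics.QuantumFieldTheory.Balaban1983to89.Beta

/-! ## Part 1 — matrix calculus: determinants of `C^k` / continuous matrix-valued maps; "onto" is open -/

section MatrixCalculus

variable {o : Type*} [Fintype o] [DecidableEq o]

/-- Leibniz expansion ⇒ the determinant is `C^k` at a point when every entry is. [folklore] -/
theorem contDiffAt_matrix_det {E : Type*} [NormedAddCommGroup E] [NormedSpace ℝ E] {k : WithTop ℕ∞}
    {M : E → Matrix o o ℝ} {x : E} (h : ∀ i j, ContDiffAt ℝ k (fun y => M y i j) x) :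
    ContDiffAt ℝ k (fun y => (M y).det) x := by
  simp_rw [Matrix.det_apply']
  refine ContDiffAt.sum fun σ _ => ?_
  exact contDiffAt_const.mul (contDiffAt_prod fun i _ => h (σ i) i)

/-- The determinant of a matrix-valued map continuous at a point is continuous at that point. [folklore] -/
theorem continuousAt_matrix_det {X : Type*} [TopologicalSpace X] {M : X → Matrix o o ℝ} {x : X}
    (h : ContinuousAt M x) : ContinuousAt (fun y => (M y).det) x :=
  ((continuous_id (X := Matrix o o ℝ)).matrix_det).continuousAt.comp h

variable {p q : Type*} [Fintype p] [Fintype q] [DecidableEq p]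

/-- A real rectangular matrix is onto (as `v ↦ Qv`) iff its Gram matrix `QQᵀ` is nonsingular. [folklore] -/
theorem mulVec_surjective_iff_det_mul_transpose_ne_zero (Q : Matrix p q ℝ) :
    Function.Surjective Q.mulVec ↔ (Q * Qᵀ).det ≠ 0 := by
  constructor
  · intro honto hdet
    obtain ⟨l, hl0, hl⟩ := Matrix.exists_mulVec_eq_zero_iff.2 hdet
    have h1 : Qᵀ *ᵥ l = 0 := by
      have h : l ⬝ᵥ (Q * Qᵀ) *ᵥ l = 0 := by rw [hl, dotProduct_zero]
      rw [← Matrix.mulVec_mulVec, Matrix.dotProduct_mulVec, ← Matrix.mulVec_transpose] at h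
      exact dotProduct_self_eq_zero.1 h
    obtain ⟨w, hw⟩ := honto l
    have h2 : l ⬝ᵥ l = 0 := by
      calc l ⬝ᵥ l = (Q *ᵥ w) ⬝ᵥ l := by rw [hw]
        _ = w ⬝ᵥ Qᵀ *ᵥ l := by rw [Matrix.dotProduct_mulVec w, Matrix.vecMul_transpose]
        _ = 0 := by rw [h1, dotProduct_zero]
    exact hl0 (dotProduct_self_eq_zero.1 h2)
  · intro hdet
    refine Matrix.mulVec_surjective_iff_exists_right_inverse.2 ⟨Qᵀ * (Q * Qᵀ)⁻¹, ?_⟩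
    rw [← Matrix.mul_assoc, Matrix.mul_nonsing_inv _ (isUnit_iff_ne_zero.2 hdet)]

end MatrixCalculus

/-! ## Part 2 — background families: `Regular` is open, `log Z` is `C^k` -/

namespace Family

variable {ι : Type*} {n m : ℕ}

section Smooth

variable [Fintype ι]

/-- `det [[Δ(B), Q(B)ᵀ],[Q(B), 0]]` is `C^k` at `B₀` when the entries of `Q(·)`, `Δ(·)` are. [folklore] -/
theorem contDiffAt_det_kkt (F : Family ι n m) {k : WithTop ℕ∞} {B₀ : ι → ℝ}
    (hQ : ∀ i j, ContDiffAt ℝ k (fun B => (F B).Q i j) B₀) (hΔ : ∀ i j, ContDiffAt ℝ k (fun B => (F B).Δ i j) B₀) :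
    ContDiffAt ℝ k (fun B => (F B).kkt.det) B₀ := by
  apply contDiffAt_matrix_det
  rintro (i | i) (j | j)
  · simpa [ConstrainedGaussian.kkt] using hΔ i j
  · simpa [ConstrainedGaussian.kkt] using hQ j i
  · simpa [ConstrainedGaussian.kkt] using hQ i j
  · simpa [ConstrainedGaussian.kkt] using (contDiffAt_const : ContDiffAt ℝ k (fun _ : ι → ℝ => (0 : ℝ)) B₀)

/-- SMOOTHNESS OF `log Z` IN THE BACKGROUND (discharges `OneLoopDictionary.smooth` at `B₀ = 0`, `k = 2`, modulo the data):
entries of `Q(·)`, `Δ(·)` of class `C^k` at `B₀` and `det (F B₀).kkt ≠ 0` ⇒ `F.logZ` is `C^k` at `B₀`.  (Under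
`(F B₀).Regular` the determinant hypothesis holds — unit pv23, `…Beta.KKTBridge` (a).) [folklore] -/
theorem contDiffAt_logZ (F : Family ι n m) {k : WithTop ℕ∞} {B₀ : ι → ℝ}
    (hQ : ∀ i j, ContDiffAt ℝ k (fun B => (F B).Q i j) B₀) (hΔ : ∀ i j, ContDiffAt ℝ k (fun B => (F B).Δ i j) B₀)
    (hdet : (F B₀).kkt.det ≠ 0) : ContDiffAt ℝ k F.logZ B₀ := by
  have hEq : F.logZ = fun B => ((n : ℝ) - m) / 2 * Real.log (2 * Real.pi) - (1 / 2 : ℝ) * Real.log (F B).kkt.det := by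
    funext B
    simp only [Family.logZ, ConstrainedGaussian.logZ, Real.log_abs]
  rw [hEq]
  exact contDiffAt_const.sub (contDiffAt_const.mul ((contDiffAt_det_kkt F hQ hΔ).log hdet))

/-- `det (CᵀΔ(B)C)` is `C^k` at `B₀` when the entries of `Δ(·)` are (`C` fixed). [folklore] -/
theorem contDiffAt_det_reduced (F : Family ι n m) {r : ℕ} (C : Matrix (Fin n) (Fin r) ℝ) {k : WithTop ℕ∞} {B₀ : ι → ℝ}
    (hΔ : ∀ i j, ContDiffAt ℝ k (fun B => (F B).Δ i j) B₀) :
    ContDiffAt ℝ k (fun B => ((F B).reduced C).det) B₀ := by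
  apply contDiffAt_matrix_det
  intro i j
  simp only [ConstrainedGaussian.reduced, Matrix.mul_apply, Matrix.transpose_apply]
  refine ContDiffAt.sum fun b _ => ?_
  refine ContDiffAt.mul ?_ contDiffAt_const
  refine ContDiffAt.sum fun a _ => ?_
  exact contDiffAt_const.mul (hΔ a b)

/-- Smoothness of B9's reduced normalisation `log Z′` in the background: entries of `Δ(·)` of class `C^k` at `B₀` and
`det(CᵀΔ(B₀)C) ≠ 0` ⇒ `F.logZred C` is `C^k` at `B₀`. [folklore] -/
theorem contDiffAt_logZred (F : Family ι n m) {r : ℕ} (C : Matrix (Fin n) (Fin r) ℝ) {k : WithTop ℕ∞} {B₀ : ι → ℝ}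
    (hΔ : ∀ i j, ContDiffAt ℝ k (fun B => (F B).Δ i j) B₀) (hdet : ((F B₀).reduced C).det ≠ 0) :
    ContDiffAt ℝ k (F.logZred C) B₀ := by
  unfold Family.logZred ConstrainedGaussian.logZred
  exact contDiffAt_const.sub (contDiffAt_const.mul ((contDiffAt_det_reduced F C hΔ).log hdet))

end Smooth

/-! ### Openness (only the topology of `ι → ℝ` is used: no finiteness of `ι` needed) -/

/-- The bordered matrix depends continuously on the background at `B₀` when `Q(·)`, `Δ(·)` do. [folklore] -/
theorem continuousAt_kkt (F : Family ι n m) {B₀ : ι → ℝ}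
    (hQ : ContinuousAt (fun B => (F B).Q) B₀) (hΔ : ContinuousAt (fun B => (F B).Δ) B₀) :
    ContinuousAt (fun B => (F B).kkt) B₀ := by
  have hG : Continuous fun P : Matrix (Fin n) (Fin n) ℝ × Matrix (Fin m) (Fin n) ℝ =>
      Matrix.fromBlocks P.1 P.2ᵀ P.2 (0 : Matrix (Fin m) (Fin m) ℝ) :=
    continuous_fst.matrix_fromBlocks continuous_snd.matrix_transpose continuous_snd continuous_const
  exact hG.continuousAt.comp (hΔ.prodMk hQ)

/-- Nonsingularity of the bordered matrix persists near `B₀`. [folklore] -/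
theorem eventually_det_kkt_ne_zero (F : Family ι n m) {B₀ : ι → ℝ}
    (hQ : ContinuousAt (fun B => (F B).Q) B₀) (hΔ : ContinuousAt (fun B => (F B).Δ) B₀)
    (hdet : (F B₀).kkt.det ≠ 0) : ∀ᶠ B in 𝓝 B₀, (F B).kkt.det ≠ 0 :=
  (continuousAt_matrix_det (continuousAt_kkt F hQ hΔ)).eventually_ne hdet

/-- "Onto" persists near `B₀`. [folklore] -/
theorem eventually_onto (F : Family ι n m) {B₀ : ι → ℝ} (hQ : ContinuousAt (fun B => (F B).Q) B₀)
    (h0 : Function.Surjective (F B₀).Q.mulVec) : ∀ᶠ B in 𝓝 B₀, Function.Surjective (F B).Q.mulVec := by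
  have hG : Continuous fun P : Matrix (Fin m) (Fin n) ℝ => (P * Pᵀ).det :=
    (continuous_id.matrix_mul continuous_id.matrix_transpose).matrix_det
  have hc : ContinuousAt (fun B => ((F B).Q * ((F B).Q)ᵀ).det) B₀ := hG.continuousAt.comp hQ
  have hne : ((F B₀).Q * ((F B₀).Q)ᵀ).det ≠ 0 := (mulVec_surjective_iff_det_mul_transpose_ne_zero _).1 h0
  exact (hc.eventually_ne hne).mono fun B hB => (mulVec_surjective_iff_det_mul_transpose_ne_zero _).2 hB

/-- `REGULAR` IS OPEN IN THE BACKGROUND (discharges `OneLoopDictionary.regular` at `B₀ = 0`, modulo the data): `Q(·)`,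
`Δ(·)` continuous at `B₀`, `Δ(B)` symmetric near `B₀`, `(F B₀).Regular` ⇒ `(F B).Regular` for all `B` near `B₀`.
Positivity on the MOVING kernel `ker Q(B)` is handled on the compact unit sphere: at each unit `y` either `Q(B₀)y ≠ 0`
or `yᵀΔ(B₀)y > 0`, both open in `(B, y)`. [folklore] -/
theorem eventually_regular (F : Family ι n m) {B₀ : ι → ℝ}
    (hQ : ContinuousAt (fun B => (F B).Q) B₀) (hΔ : ContinuousAt (fun B => (F B).Δ) B₀)
    (hsymm : ∀ᶠ B in 𝓝 B₀, (F B).Δ.IsSymm) (h0 : (F B₀).Regular) : ∀ᶠ B in 𝓝 B₀, (F B).Regular := by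
  have honto := eventually_onto F hQ h0.onto
  -- positivity on the moving kernel, uniformly on the unit sphere
  have hpos : ∀ᶠ B in 𝓝 B₀, ∀ y ∈ Metric.sphere (0 : Fin n → ℝ) 1,
      ((F B).Q *ᵥ y ≠ 0 ∨ 0 < y ⬝ᵥ (F B).Δ *ᵥ y) := by
    refine (isCompact_sphere (0 : Fin n → ℝ) 1).eventually_forall_of_forall_eventually
      (P := fun B y => (F B).Q *ᵥ y ≠ 0 ∨ 0 < y ⬝ᵥ (F B).Δ *ᵥ y) ?_
    intro y hy
    have hy1 : ‖y‖ = 1 := mem_sphere_zero_iff_norm.1 hy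
    have hy0 : y ≠ 0 := by
      intro h; rw [h, norm_zero] at hy1; exact zero_ne_one hy1
    have hQ' : ContinuousAt (fun z : (ι → ℝ) × (Fin n → ℝ) => (F z.1).Q) (B₀, y) :=
      hQ.comp_of_eq continuousAt_fst rfl
    have hΔ' : ContinuousAt (fun z : (ι → ℝ) × (Fin n → ℝ) => (F z.1).Δ) (B₀, y) :=
      hΔ.comp_of_eq continuousAt_fst rfl
    have hG1 : Continuous fun P : Matrix (Fin m) (Fin n) ℝ × (Fin n → ℝ) => P.1 *ᵥ P.2 :=
      continuous_fst.matrix_mulVec continuous_snd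
    have hG2 : Continuous fun P : Matrix (Fin n) (Fin n) ℝ × (Fin n → ℝ) => P.2 ⬝ᵥ P.1 *ᵥ P.2 :=
      continuous_snd.dotProduct (continuous_fst.matrix_mulVec continuous_snd)
    have hQc : ContinuousAt (fun z : (ι → ℝ) × (Fin n → ℝ) => (F z.1).Q *ᵥ z.2) (B₀, y) :=
      hG1.continuousAt.comp (hQ'.prodMk continuousAt_snd)
    have hΔc : ContinuousAt (fun z : (ι → ℝ) × (Fin n → ℝ) => z.2 ⬝ᵥ (F z.1).Δ *ᵥ z.2) (B₀, y) :=
      hG2.continuousAt.comp (hΔ'.prodMk continuousAt_snd)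
    by_cases hQy : (F B₀).Q *ᵥ y = 0
    · have hp : (0 : ℝ) < y ⬝ᵥ (F B₀).Δ *ᵥ y := h0.posKer y hy0 hQy
      exact (continuousAt_const.eventually_lt hΔc hp).mono fun z hz => Or.inr hz
    · exact (hQc.eventually_ne hQy).mono fun z hz => Or.inl hz
  filter_upwards [honto, hpos, hsymm] with B hB1 hB2 hB3
  refine ⟨hB1, hB3, ?_⟩
  intro v hv hQv
  have hc0 : 0 < ‖v‖ := norm_pos_iff.2 hv
  have hu : ‖v‖⁻¹ • v ∈ Metric.sphere (0 : Fin n → ℝ) 1 := by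
    rw [mem_sphere_zero_iff_norm, norm_smul, norm_inv, norm_norm, inv_mul_cancel₀ hc0.ne']
  rcases hB2 _ hu with h | h
  · exact (h (by rw [Matrix.mulVec_smul, hQv, smul_zero])).elim
  · rw [Matrix.mulVec_smul, dotProduct_smul, smul_dotProduct, smul_eq_mul, smul_eq_mul] at h
    exact (mul_pos_iff_of_pos_left (inv_pos.2 hc0)).1 ((mul_pos_iff_of_pos_left (inv_pos.2 hc0)).1 h)

/-- Packaged for `OneLoopDictionary` instances at the base point `0`: continuity + symmetry of the data near `0`,
`Regular` and `det K ≠ 0` at `0`, entries `C²` at `0` ⇒ both hypothesis fields (`regular`, `smooth`) for this family.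
[folklore] -/
theorem regular_and_smooth_at_zero [Fintype ι] (F : Family ι n m)
    (hQ : ContinuousAt (fun B => (F B).Q) 0) (hΔ : ContinuousAt (fun B => (F B).Δ) 0)
    (hsymm : ∀ᶠ B in 𝓝 (0 : ι → ℝ), (F B).Δ.IsSymm) (h0 : (F 0).Regular)
    (hQ2 : ∀ i j, ContDiffAt ℝ 2 (fun B => (F B).Q i j) 0) (hΔ2 : ∀ i j, ContDiffAt ℝ 2 (fun B => (F B).Δ i j) 0)
    (hdet : (F 0).kkt.det ≠ 0) :
    (∀ᶠ B in 𝓝 (0 : ι → ℝ), (F B).Regular) ∧ ContDiffAt ℝ 2 F.logZ 0 :=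
  ⟨eventually_regular F hQ hΔ hsymm h0, contDiffAt_logZ F hQ2 hΔ2 hdet⟩

end Family

end Literature.MathematicalPhysics.QuantumFieldTheory.Balaban1983to89.Beta

end
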